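import Literature.Computability.MetaComplexity.ConstructiveSeparationsRefuter
import Literature.Computability.Complexity.NEXPCertificates
import Literature.Computability.Complexity.BPClosureProofs
import Literature.Computability.Complexity.SipserGacsLautemann
import Literature.Computability.Complexity.KannanLanguageAE
import Literature.Computability.Complexity.BPPTruthTableClosure
import HarnessLib

/-!
# Constructive separations: proof of Thm. 1.2 of Chen–Jin–Santhanam–Williams for `𝒟 = NEXP`

Proof module `ConstructiveSeparationsNEXP.lean` for the `(BPP, NEXP)` instance of the named facts of
`ConstructiveSeparations.lean` (D-0014; the siblings `ConstructiveSeparationsProofs.lean`,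
`ConstructiveSeparationsEXP.lean`, `ConstructiveSeparationsBPPNP.lean` hold the `(P, NP)`, `(BPP, EXP)`,
`(BPP, NP)` instances): discharges `constructiveSeparation_of_not_subset_BPP_NEXP` — "`NEXP ⊄ BPP`
implies a `BPP`-constructive separation of every paddable `NEXP`-complete language from `BPP`" —
following the printed proof,

* L. Chen, C. Jin, R. Santhanam, R. Williams, *Constructive separations and their consequences*,
  FOCS 2021 / TheoretiCS 3 (2024) = arXiv:2203.14379 [ChenEtAl2022], §5.1: Thm. 4 — the theorem
  "Refuters for `PSPACE`, `EXP` and `NEXP`" ("Let `𝒞 ∈ {P, BPP, ZPP}` and `𝒟` with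
  `(∃ poly) 𝒟 ⊆ 𝒟`, `(∀ poly) 𝒟 ⊆ 𝒟`. If `𝒟 ⊄ 𝒞`, then for every paddable `𝒟`-complete `L` there is a
  `𝒞`-constructive separation of `L ∉ 𝒞`"), Lemma 6 (constant-size list-refuters give refuters,
  Def. 4) and Cor. 3 (the pairs `{P, ZPP, BPP} × {PSPACE, EXP, NEXP, EXP^NP}`; for `𝒟 = NEXP` "the
  inclusion `(∀ poly(n)) NEXP ⊆ NEXP` follows from concatenating the witnesses").

Numbering: "Def. 4 / Lemma 6 / Thm. 4 / Cor. 3 (§5, §5.1)" is the numbering of the held text of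
arXiv:2203.14379, as in the sibling `ConstructiveSeparationsProofs.lean`; `Thm. 1.2`, `Def. 1.1`
are those of the paper's introduction (the engine `ConstructiveSeparationsRefuter.lean` calls the
same three results "Thm. 5.2 / Lemma 5.1 / Cor. 5.3").

The engine (the prefix-search list-refuter, its seven randomised slot refuters, the coupling with
the canonical run and the union bound) is `ConstructiveSeparationsRefuter.lean`; the closure
properties of `NEXP` are `Complexity/NEXPCertificates.lean`. Here:

* the prefix-search languages `G¹ = {⟨1ⁿ, z⟩ | ∃ y ∈ {0,1}ⁿ, z ⊑ y, y ∈ L ∖ A}` and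
  `H⁰ = (G⁰)ᶜ = {⟨1ⁿ, z⟩ | ∀ y ∈ {0,1}ⁿ, z ⊑ y → y ∈ L ∨ y ∉ A}` (`CJSW.G1`, `CJSW.H0`), their
  membership in any class `𝒟 ⊇ P ∪ BPP` closed under `⊓`, `⊔`, `FP`-preimages, `∃ᵖ`, `∀ᵖ`;
* the general theorem `hasBPPConstructiveSeparation_of_closure` (Thm. 4 for `𝒞 = BPP` and
  such a `𝒟`): either `A` errs about `L` on only finitely many lengths — then `L ∈ BPP` by the
  invariance of `BPP` under finite variations (`mem_BPP_of_eqOn_le`), so `𝒟 ⊆ BPP` by completeness and `mem_BPP_of_karpReducible`,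
  contradiction — or on infinitely many, and then one of the seven slot refuters succeeds
  infinitely often (pigeonhole), with probability `≥ 1 - 4n·2^{-ℓ(n)} ≥ 2/3`;
* `constructiveSeparation_of_not_subset_BPP_NEXP_holds`.

## References

* [ChenEtAl2022] Thm. 1.2, §5.1 (Thm. 4, Lemma 6, Cor. 3), Def. 1.1.
* S. Arora, B. Barak, *Computational Complexity: A Modern Approach*, CUP 2009, Thm. 7.10, §2.6.2
  [AroraBarak2009].
-/

namespace Literature.Computability.MetaComplexity

open _root_.Computability Literature.Computability.Complexity Polynomial Brick Plumb NEXPCert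
open scoped Literature.Computability.Complexity.Notation

namespace CJSW

/-! ### The prefix-search languages -/

section Languages

variable (L A : Language Bool)

/-- The equaliser of two string maps, typed as a language. [folklore] -/
def eqLang (f g : List Bool → List Bool) : Language Bool := {v | f v = g v}

/-- Membership in the equaliser language. [folklore] -/
theorem mem_eqLang {f g : List Bool → List Bool} {w : List Bool} : w ∈ eqLang f g ↔ f w = g w := Iff.rfl

/-- The equaliser of two `FP` maps is in `P` (`setOf_apply_eq_apply_mem_P`). [folklore] -/
theorem eqLang_mem_P {f g : List Bool → List Bool} (hf : f ∈ FP) (hg : g ∈ FP) : eqLang f g ∈ Classes.P :=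
  setOf_apply_eq_apply_mem_P hf hg

/-- Well-formed extensions: `⟨⟨u, z⟩, y⟩` with `z ⊑ y` and `|y| = |u|`. [cite: ChenEtAl2022, §5.1 (the language `G_A`)] -/
noncomputable def Pfx : Language Bool :=
  eqLang (takeFn ∘ fanoutFn (sndF ∘ fstF) sndF) (sndF ∘ fstF) ⊓ preimageL (fanoutFn (fstF ∘ fstF) sndF) (LenEq X)

/-- `Pfx ∈ P`. [folklore] -/
theorem Pfx_mem_P : Pfx ∈ Classes.P :=
  inter_mem_P (eqLang_mem_P (comp_mem_FP takeFn_mem_FP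
      (fanoutFn_mem_FP (comp_mem_FP sndF_mem_FP fstF_mem_FP) sndF_mem_FP)) (comp_mem_FP sndF_mem_FP fstF_mem_FP))
    (preimageL_mem_P (LenEq_mem_P X) (fanoutFn_mem_FP (comp_mem_FP fstF_mem_FP fstF_mem_FP) sndF_mem_FP))

/-- Membership in `Pfx` on `⟨⟨u, z⟩, y⟩`. [folklore] -/
theorem mem_Pfx (u z y : List Bool) : boolPair (boolPair u z) y ∈ Pfx ↔ z <+: y ∧ y.length = u.length := by
  rw [Pfx, NEXPCert.mem_inf_iff, mem_preimageL, mem_eqLang]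
  simp only [Function.comp_apply, fanoutFn_apply, fstF_boolPair, sndF_boolPair,
    takeFn_boolPair, boolPair_mem_LenEq, eval_X]
  rw [List.prefix_iff_eq_take]
  exact ⟨fun h => ⟨h.1.symm, h.2⟩, fun h => ⟨h.1.symm, h.2⟩⟩

/-- The matrix of `G¹`: the extension is well formed, in `L`, not in `A`. [cite: ChenEtAl2022, §5.1 (the language `G_A^{(1)}`)] -/
noncomputable def T1 : Language Bool := Pfx ⊓ (preimageL sndF L ⊓ preimageL sndF Aᶜ)

/-- The matrix of `H⁰ = (G⁰)ᶜ`: ill formed, or in `L`, or not in `A`. [cite: ChenEtAl2022, §5.1 (the language `G_A^{(0)}`)] -/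
noncomputable def T0 : Language Bool := Pfxᶜ ⊔ (preimageL sndF L ⊔ preimageL sndF Aᶜ)

/-- **`G¹ = {⟨1ⁿ, z⟩ | ∃ y ∈ {0,1}ⁿ, z ⊑ y, y ∈ L, y ∉ A}`** in `∃ᵖ` form. [cite: ChenEtAl2022, §5.1 (the language `G_A^{(1)}`)] -/
def G1 : Language Bool := {w | ∃ y : List Bool, y.length ≤ (X : Polynomial ℕ).eval w.length ∧ boolPair w y ∈ T1 L A}

/-- **`H⁰ = {⟨1ⁿ, z⟩ | ∀ y ∈ {0,1}ⁿ, z ⊑ y → y ∈ L ∨ y ∉ A}`**, the complement of `G⁰`, in `∀ᵖ` form.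
[cite: ChenEtAl2022, §5.1 (the language `G_A^{(0)}`)] -/
def H0 : Language Bool := {w | ∀ y : List Bool, y.length ≤ (X : Polynomial ℕ).eval w.length → boolPair w y ∈ T0 L A}

variable {L A}

/-- Membership in the matrix `T1` on `⟨⟨u, z⟩, y⟩`. [folklore] -/
theorem mem_T1 (u z y : List Bool) :
    boolPair (boolPair u z) y ∈ T1 L A ↔ (z <+: y ∧ y.length = u.length) ∧ y ∈ L ∧ y ∉ A := by
  rw [T1, NEXPCert.mem_inf_iff, NEXPCert.mem_inf_iff, mem_preimageL, mem_preimageL, mem_compl_iff, mem_Pfx, sndF_boolPair]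

/-- Membership in the matrix `T0` on `⟨⟨u, z⟩, y⟩`. [folklore] -/
theorem mem_T0 (u z y : List Bool) :
    boolPair (boolPair u z) y ∈ T0 L A ↔ ¬ (z <+: y ∧ y.length = u.length) ∨ y ∈ L ∨ y ∉ A := by
  rw [T0, mem_sup_iff, mem_sup_iff, mem_compl_iff, mem_preimageL, mem_preimageL, mem_compl_iff, mem_Pfx,
    sndF_boolPair]

/-- Membership in `G¹` at `⟨1ⁿ, z⟩`. [cite: ChenEtAl2022, §5.1] -/
theorem mem_G1 (n : ℕ) (z : List Bool) :
    boolPair (ones n) z ∈ G1 L A ↔ ∃ y : List Bool, y.length = n ∧ z <+: y ∧ y ∈ L ∧ y ∉ A := by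
  constructor
  · rintro ⟨y, -, hy⟩
    rw [mem_T1, List.length_replicate] at hy
    obtain ⟨⟨hzy, hlen⟩, hL, hA⟩ := hy
    exact ⟨y, hlen, hzy, hL, hA⟩
  · rintro ⟨y, hy, hzy, hL, hA⟩
    refine ⟨y, ?_, ?_⟩
    · rw [eval_X, length_boolPair, List.length_replicate]
      omega
    · rw [mem_T1, List.length_replicate]
      exact ⟨⟨hzy, hy⟩, hL, hA⟩

/-- Membership in `H⁰` at `⟨1ⁿ, z⟩`. [cite: ChenEtAl2022, §5.1] -/
theorem mem_H0 (n : ℕ) (z : List Bool) :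
    boolPair (ones n) z ∈ H0 L A ↔ ∀ y : List Bool, y.length = n → z <+: y → (y ∈ L ∨ y ∉ A) := by
  constructor
  · intro h y hy hzy
    have hlen : y.length ≤ (X : Polynomial ℕ).eval (boolPair (ones n) z).length := by
      rw [eval_X, length_boolPair, List.length_replicate]; omega
    have h' := h y hlen
    rw [mem_T0, List.length_replicate] at h'
    rcases h' with h' | h'
    · exact absurd ⟨hzy, hy⟩ h'
    · exact h'
  · intro h y _
    rw [mem_T0, List.length_replicate]
    by_cases hw : z <+: y ∧ y.length = n
    · exact Or.inr (h y hw.2 hw.1)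
    · exact Or.inl hw

/-- **The prefix-search languages lie in any class containing `L`, `Aᶜ`, `P` and closed under
`⊓`, `⊔`, `∃ᵖ`, `∀ᵖ`** (for `NEXP`: `NEXPCertificates.lean`). [cite: ChenEtAl2022, §5.1 (proof of Thm. 4: "`G_A^{(1)} ∈ (∃ poly) 𝒟 ⊆ 𝒟`, `G_A^{(0)} ∈ (∃ poly) co𝒟`")] -/
theorem G1_mem {D : Set (Language Bool)} (hPD : Classes.P ⊆ D)
    (hinter : ∀ L₁ ∈ D, ∀ L₂ ∈ D, L₁ ⊓ L₂ ∈ D)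
    (hpre : ∀ L' ∈ D, ∀ f ∈ FP, preimageL f L' ∈ D) (hE : polyExists D ⊆ D)
    (hL : L ∈ D) (hAc : Aᶜ ∈ D) : G1 L A ∈ D := by
  refine hE ⟨T1 L A, ?_, X, fun w => Iff.rfl⟩
  exact hinter _ (hPD Pfx_mem_P) _ (hinter _ (hpre _ hL _ sndF_mem_FP) _ (hpre _ hAc _ sndF_mem_FP))

/-- `H⁰ ∈ 𝒟` for a class `𝒟 ∋ L, Aᶜ` containing `P` and closed under `⊔`, preimages and `∀ᵖ`. [folklore] -/
theorem H0_mem {D : Set (Language Bool)} (hPD : Classes.P ⊆ D)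
    (hunion : ∀ L₁ ∈ D, ∀ L₂ ∈ D, L₁ ⊔ L₂ ∈ D)
    (hpre : ∀ L' ∈ D, ∀ f ∈ FP, preimageL f L' ∈ D) (hAll : polyForall D ⊆ D)
    (hL : L ∈ D) (hAc : Aᶜ ∈ D) : H0 L A ∈ D := by
  refine hAll (mem_polyForall_iff.2 ⟨T0 L A, ?_, X, fun w => Iff.rfl⟩)
  exact hunion _ (hPD (compl_mem_P_iff.2 Pfx_mem_P)) _
    (hunion _ (hpre _ hL _ sndF_mem_FP) _ (hpre _ hAc _ sndF_mem_FP))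

end Languages

/-! ### The padding map as a string function -/

/-- **From a length padding to an `FP` string map** `padS ⟨x, 1ᵐ⟩ = pad (x, m)`.
[cite: ChenEtAl2022, §5.1 (proof of Thm. 4: "since `L` is paddable, we may assume the queries …
have length exactly `ℓ(n)`")] -/
theorem exists_padS {L : Language Bool} (h : IsLengthPaddable L) :
    ∃ padS : List Bool → List Bool, padS ∈ FP ∧
      ∀ (x : List Bool) (m : ℕ), x.length ≤ m →
        (padS (boolPair x (ones m))).length = m ∧ (padS (boolPair x (ones m)) ∈ L ↔ x ∈ L) := by
  obtain ⟨pad, hpad, hspec⟩ := h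
  let ψ : List Bool → List Bool × ℕ := fun v => (fstF v, (sndF v).length)
  have hg : fanoutFn fstF (onesFn ∘ sndF) ∈ FP :=
    fanoutFn_mem_FP fstF_mem_FP (comp_mem_FP onesFn_mem_FP sndF_mem_FP)
  have hψ : PolyTimeComputable (id : List Bool → List Bool)
      (fun p : List Bool × ℕ => boolPair p.1 (unaryEncodeNat p.2)) ψ :=
    PolyTimeComputable.of_encode_eq (ea := (id : List Bool → List Bool)) (eb := (id : List Bool → List Bool))
      (f := fanoutFn fstF (onesFn ∘ sndF)) (ea' := (id : List Bool → List Bool))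
      (eb' := fun p : List Bool × ℕ => boolPair p.1 (unaryEncodeNat p.2)) (f' := ψ)
      id (fun _ => rfl) (fun v => by simp [ψ, fanoutFn_apply, onesFn]) hg
  refine ⟨pad ∘ ψ, PolyTimeComputable.comp_holds hpad hψ, fun x m hx => ?_⟩
  have e : (pad ∘ ψ) (boolPair x (ones m)) = pad (x, m) := by
    simp [ψ]
  rw [e]
  exact hspec x m hx

/-! ### Query lengths: every polynomial is below some `(n + c₀)^{2^J}` -/

/-- `nᵈ + c ≤ (n + c)ᵈ` for `d ≥ 1`. [folklore] -/
theorem pow_add_ge (n c : ℕ) : ∀ d : ℕ, 1 ≤ d → n ^ d + c ≤ (n + c) ^ d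
  | 0, h => absurd h (by decide)
  | 1, _ => by simp
  | d + 2, _ => by
    have ih := pow_add_ge n c (d + 1) (by omega)
    have hc : c ≤ c * c := by
      rcases Nat.eq_zero_or_pos c with rfl | hc
      · simp
      · exact Nat.le_mul_of_pos_left c hc
    calc n ^ (d + 2) + c ≤ (n ^ (d + 1) + c) * (n + c) := by
          rw [pow_succ]
          nlinarith [Nat.zero_le (n ^ (d + 1)), Nat.zero_le (c * n)]
      _ ≤ (n + c) ^ (d + 1) * (n + c) := Nat.mul_le_mul_right _ ih
      _ = (n + c) ^ (d + 2) := by rw [← pow_succ]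

/-- `Q(n) ≤ (n + c₀)^{2^J}` for suitable `J`, `c₀ ≥ 1`. [folklore] -/
theorem exists_le_pow_two_pow (Q : Polynomial ℕ) : ∃ J c₀ : ℕ, 1 ≤ c₀ ∧ ∀ n, Q.eval n ≤ (n + c₀) ^ 2 ^ J := by
  obtain ⟨d, C, h⟩ := exists_eval_le_pow_add Q
  refine ⟨d, C + 1, by omega, fun n => (h n).trans ?_⟩
  rcases Nat.eq_zero_or_pos d with rfl | hd
  · simp only [pow_zero, pow_one]
    omega
  · calc n ^ d + C ≤ n ^ d + (C + 1) := by omega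
      _ ≤ (n + (C + 1)) ^ d := pow_add_ge n (C + 1) d hd
      _ ≤ (n + (C + 1)) ^ 2 ^ d := Nat.pow_le_pow_right (by omega) Nat.lt_two_pow_self.le

/-! ### Thm. 4 for `𝒞 = BPP`: the assembly -/

/-- `12 n ≤ 2ⁿ` for `n ≥ 7`. [folklore] -/
theorem twelve_mul_le_two_pow {n : ℕ} (hn : 7 ≤ n) : 12 * n ≤ 2 ^ n := by
  induction n, hn using Nat.le_induction with
  | base => norm_num
  | succ n _ ih =>
    rw [pow_succ]
    omega

/-- The success probability is at least `2/3` once `n ≥ 7` and `ℓ(n) ≥ n`. [folklore] -/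
theorem two_thirds_le {n e : ℕ} (hn : 7 ≤ n) (he : n ≤ e) : (2 : ℝ) / 3 ≤ 1 - 4 * n * (1 / 2 ^ e) := by
  have h1 : (12 * n : ℝ) ≤ 2 ^ n := by exact_mod_cast twelve_mul_le_two_pow hn
  have h2 : (2 : ℝ) ^ n ≤ 2 ^ e := pow_le_pow_right₀ (by norm_num) he
  have h3 : (0 : ℝ) < 2 ^ e := by positivity
  have h4 : (4 * n : ℝ) * (1 / 2 ^ e) ≤ 1 / 3 := by
    rw [mul_one_div, div_le_iff₀ h3]
    linarith
  linarith

end CJSW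

open CJSW RefuterKit

/-- **Thm. 4 of Chen–Jin–Santhanam–Williams for `𝒞 = BPP`** (with Lemma 6), for any class `𝒟`
that contains `P` and `BPP` and is closed under `⊓`, `⊔`, `FP`-preimages and polynomially bounded
`∃`, `∀`: if `𝒟 ⊄ BPP` then every length-paddable `𝒟`-complete language `L` is `BPP`-constructively
separated from `BPP`. Given `A ∈ BPP`: if `A` errs about `L` on finitely many lengths only, `L ∈ BPP`
by finite patching and `𝒟 ⊆ BPP` by completeness — impossible; otherwise one of the seven slot
refuters of the prefix-search list-refuter (entries `x`, and the queries at `x`, `x0`, `x1`,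
`exists_slot_error`) is right on infinitely many of those lengths (pigeonhole) and, being
pseudo-deterministic (`pr_refuter_ge`: probability `≥ 1 - 4n·2^{-ℓ(n)} ≥ 2/3`), is a
`BPP`-refuter. [cite: ChenEtAl2022, §5.1 (Thm. 4 with Lemma 6)] -/
theorem hasBPPConstructiveSeparation_of_closure {D : Set (Language Bool)}
    (hPD : Classes.P ⊆ D) (hBD : BPP ⊆ D)
    (hinter : ∀ L₁ ∈ D, ∀ L₂ ∈ D, L₁ ⊓ L₂ ∈ D) (hunion : ∀ L₁ ∈ D, ∀ L₂ ∈ D, L₁ ⊔ L₂ ∈ D)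
    (hpre : ∀ L' ∈ D, ∀ f ∈ FP, preimageL f L' ∈ D)
    (hE : polyExists D ⊆ D) (hAll : polyForall D ⊆ D)
    (hD : ¬ D ⊆ BPP) {L : Language Bool} (hL : IsComplete D L) (hpad : IsLengthPaddable L) :
    HasBPPConstructiveSeparation L BPP := by
  classical
  intro A hA
  set Bad : Set ℕ := {n | ∃ y : List Bool, y.length = n ∧ ¬ (y ∈ L ↔ y ∈ A)} with hBad
  by_cases hfin : Bad.Finite
  · -- finitely many bad lengths: `L ∈ BPP`, hence `D ⊆ BPP`
    exfalso
    obtain ⟨N, hN⟩ := hfin.bddAbove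
    have hagree : ∀ y : List Bool, N + 1 ≤ y.length → (y ∈ L ↔ y ∈ A) := fun y hy => by
      by_contra hne
      have : y.length ∈ Bad := ⟨y, rfl, hne⟩
      have := hN this
      omega
    have hLBPP : L ∈ BPP := mem_BPP_of_eqOn_le hA (N + 1) hagree
    exact hD fun L' hL' => mem_BPP_of_karpReducible (hL.2 L' hL') hLBPP
  -- infinitely many bad lengths: build the kit
  have hinf : Bad.Infinite := hfin
  obtain ⟨A', hA'P, qA, hamp⟩ := BPP_subset_bpErr_two_pow 1 hA
  have hAc : Aᶜ ∈ D := by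
    apply hBD
    have h2 : A ∈ co BPP := by rw [co_BPP_holds]; exact hA
    exact h2
  obtain ⟨f₁, hf₁, hG⟩ := hL.2 _ (G1_mem hPD hinter hpre hE hL.1 hAc : G1 L A ∈ D)
  obtain ⟨f₀, hf₀, hH⟩ := hL.2 _ (H0_mem hPD hunion hpre hAll hL.1 hAc : H0 L A ∈ D)
  obtain ⟨padS, hpadS, hpadspec⟩ := exists_padS hpad
  obtain ⟨s₁, hs₁⟩ := exists_poly_length_le_of_mem_FP hf₁
  obtain ⟨s₀, hs₀⟩ := exists_poly_length_le_of_mem_FP hf₀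
  obtain ⟨J, c₀, hc₀, hJ⟩ := exists_le_pow_two_pow ((s₁ + s₀).comp (3 * X + 3) + X)
  let ℓ : Polynomial ℕ := (X + Polynomial.C c₀) ^ 2 ^ J
  have hℓ : ∀ n, ℓ.eval n = (n + c₀) ^ 2 ^ J := fun n => by simp [ℓ]
  have hℓn : ∀ n, n ≤ ℓ.eval n := fun n => by
    have := hJ n
    simp only [eval_add, eval_X] at this
    rw [hℓ]; omega
  have hℓf : ∀ (b : Bool) (n : ℕ) (w : List Bool), w.length ≤ 3 * n + 3 →
      ((if b then f₁ else f₀) w).length ≤ ℓ.eval n := fun b n w hw => by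
    have h1 := hJ n
    simp only [eval_add, eval_comp, eval_mul, eval_ofNat, eval_X] at h1
    have h2 : (s₁ + s₀).eval w.length ≤ (s₁ + s₀).eval (3 * n + 3) := TM2Iter.eval_mono _ hw
    simp only [eval_add] at h2
    rw [hℓ]
    cases b
    · have := hs₀ w; simp only [Bool.false_eq_true, if_false]; omega
    · have := hs₁ w; simp only [if_true]; omega
  let κ : RefuterKit := ⟨f₁, f₀, padS, A', ℓ, qA⟩
  -- the queries: exact length, and they reduce the two prefix-search questions
  have hqry : ∀ (b : Bool) (n : ℕ) (z : List Bool), z.length ≤ n + 1 →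
      (κ.qry b n z).length = ℓ.eval n ∧
        (κ.qry b n z ∈ L ↔ (if b then f₁ else f₀) (boolPair (ones n) z) ∈ L) := fun b n z hz => by
    have hw : (boolPair (ones n) z).length ≤ 3 * n + 3 := by
      rw [length_boolPair, List.length_replicate]; omega
    exact hpadspec _ _ (hℓf b n _ hw)
  have hG' : ∀ w : List Bool, w ∈ G1 L A ↔ f₁ w ∈ L := hG
  have hH' : ∀ w : List Bool, w ∈ H0 L A ↔ f₀ w ∈ L := hH
  have hq1 : ∀ (n : ℕ) (z : List Bool), z.length ≤ n + 1 →
      (κ.qry true n z ∈ L ↔ ∃ y : List Bool, y.length = n ∧ z <+: y ∧ y ∈ L ∧ y ∉ A) := fun n z hz => by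
    rw [(hqry true n z hz).2, if_pos rfl, ← hG', mem_G1]
  have hq0 : ∀ (n : ℕ) (z : List Bool), z.length ≤ n + 1 →
      (κ.qry false n z ∈ L ↔ ∀ y : List Bool, y.length = n → z <+: y → (y ∈ L ∨ y ∉ A)) := fun n z hz => by
    rw [(hqry false n z hz).2, if_neg Bool.false_ne_true, ← hH', mem_H0]
  -- the canonical prefix is short
  have hxlen : ∀ n k, (κ.canon A n k).2.length ≤ k := fun n k => by
    obtain ⟨h1, h2, -⟩ := κ.canon_inv A n k
    cases hf : (κ.canon A n k).1
    · exact (h1 hf).le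
    · exact (h2 hf).1.le
  -- pigeonhole over the seven slots
  let S : Fin 7 → Set ℕ := fun i =>
    {n | ¬ (κ.slotVal n (κ.canon A n n).2 i ∈ L ↔ κ.slotVal n (κ.canon A n n).2 i ∈ A) ∧
      (i = 0 → (κ.canon A n n).2.length = n)}
  have hcover : Bad ⊆ ⋃ i, S i := fun n hn => by
    obtain ⟨i, hi⟩ := κ.exists_slot_error (L := L) (A := A) (n := n) hn
      (fun z hz => hq1 n z (by omega)) (fun z hz => hq0 n z (by omega))
    exact Set.mem_iUnion.2 ⟨i, hi⟩
  obtain ⟨i, hSi⟩ : ∃ i, (S i).Infinite := by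
    by_contra hall
    push Not at hall
    exact hinf ((Set.finite_iUnion fun i => hall i).subset hcover)
  -- common facts for the success bound
  have hlen : ∀ n, ∀ t < 4 * n, (κ.cqry A n t).length = κ.ℓ.eval n := fun n t ht => by
    refine (hqry _ n _ ?_).1
    rw [List.length_append, List.length_singleton]
    have := hxlen n (t / 4)
    omega
  have hamp' : ∀ n, ∀ y : List Bool, y.length = κ.ℓ.eval n →
      uniformProb (κ.qA.eval y.length) (κ.badCoins A y) ≤ 1 / 2 ^ (κ.ℓ.eval n) := fun n y hy => by
    have := hamp y
    rw [pow_one] at this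
    rw [← hy]
    exact this
  -- the finishing argument, for a preparation `P`, budget `Qc` and input-length map `mOf`
  have finish : ∀ (P : List Bool → List Bool) (Qc : Polynomial ℕ) (mOf : ℕ → ℕ),
      P ∈ FP → Function.Injective mOf →
      (∀ (n : ℕ) (r : List Bool), P (boolPair (ones (mOf n)) r) = boolPair (ones n) r) →
      (∀ n, 4 * n * κ.K n ≤ Qc.eval (mOf n)) → (∀ n, n ≤ mOf n) →
      (∀ n ∈ S i, (κ.slotVal n (κ.canon A n n).2 i).length = mOf n) →
      IsBPPRefuter L A (κ.refuter P i Qc) := fun P Qc mOf hPfp hinj hP hQ hmn hslot => by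
    refine ⟨isPolyTime_refuter (κ := κ) hf₁ hf₀ hpadS hA'P hPfp i Qc, ⟨Qc, fun m => rfl⟩, ?_⟩
    rw [Nat.frequently_atTop_iff_infinite]
    have hsub : mOf '' (S i ∩ {n | 7 ≤ n}) ⊆
        {m | (2 : ℝ) / 3 ≤ (κ.refuter P i Qc).pr unaryEncodeNat m {x | x.length = m ∧ (x ∈ L ↔ x ∉ A)}} := by
      rintro m ⟨n, ⟨hnS, hn7⟩, rfl⟩
      have hE : κ.slotVal n (κ.canon A n n).2 i ∈ {x : List Bool | x.length = mOf n ∧ (x ∈ L ↔ x ∉ A)} :=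
        ⟨hslot n hnS, (not_iff_comm.1 (not_iff.1 hnS.1)).symm⟩
      refine le_trans ?_ (κ.pr_refuter_ge A (hP n) (hQ n) (hlen n) (hamp' n) hE)
      exact two_thirds_le hn7 (hℓn n)
    refine Set.Infinite.mono hsub (Set.Infinite.image hinj.injOn ?_)
    intro hf7
    apply hSi
    refine (hf7.union (Set.finite_lt_nat 7)).subset fun n hn => ?_
    by_cases h7 : 7 ≤ n
    · exact Or.inl ⟨hn, h7⟩
    · exact Or.inr (not_le.1 h7)
  -- slot `0`: input length `n` itself; slots `1 … 6`: input length `ℓ(n)`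
  by_cases hi : i = 0
  · subst hi
    refine ⟨κ.refuter id 0 (Polynomial.C 4 * X * κ.qA.comp κ.ℓ), finish id _ id OracleCompose.id_mem_FP
      Function.injective_id (fun n r => rfl) (fun n => ?_) (fun n => le_rfl) (fun n hn => hn.2 rfl)⟩
    simp [RefuterKit.K]
  · refine ⟨κ.refuter (prepF J c₀) i (Polynomial.C 4 * X * κ.qA), finish (prepF J c₀) _ (fun n => κ.ℓ.eval n)
      (prepF_mem_FP J c₀) ?_ (fun n r => ?_) (fun n => ?_) hℓn (fun n _ => ?_)⟩
    · intro a b hab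
      have : (a + c₀) ^ 2 ^ J = (b + c₀) ^ 2 ^ J := by rw [← hℓ, ← hℓ]; exact hab
      have := Nat.pow_left_injective (Nat.two_pow_pos J).ne' this
      omega
    · show prepF J c₀ (boolPair (ones (κ.ℓ.eval n)) r) = _
      rw [prepF_apply, show κ.ℓ = ℓ from rfl, hℓ, linv_pow]
    · simp only [eval_mul, eval_C, eval_X, RefuterKit.K]
      have := hℓn n
      have := Nat.mul_le_mul_right (κ.qA.eval (κ.ℓ.eval n)) (Nat.mul_le_mul_left 4 this)
      linarith
    · have hx := hxlen n n
      fin_cases i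
      · exact absurd rfl hi
      all_goals
        simp only [RefuterKit.slotVal]
        refine (hqry _ n _ ?_).1
        try simp only [List.length_append, List.length_cons, List.length_nil]
        omega

/-- **Discharge of `constructiveSeparation_of_not_subset_BPP_NEXP`** (Chen–Jin–Santhanam–Williams
2022, Thm. 1.2 for `(𝒞, 𝒟) = (BPP, NEXP)`, i.e. Cor. 3 of §5.1): `NEXP ⊄ BPP` implies that every
length-paddable `NEXP`-complete language is `BPP`-constructively separated from `BPP`. The closure
hypotheses of `hasBPPConstructiveSeparation_of_closure` for `𝒟 = NEXP` are `P_subset_NEXP`,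
`BPP ⊆ Σ₂ᵖ ⊆ PH ⊆ EXP ⊆ NEXP`, `inter_mem_NEXP`, `union_mem_NEXP`, `preimage_mem_NEXP_of_mem_FP`,
`polyExists_NEXP_subset_NEXP` and `polyForall_NEXP_subset_NEXP` ("the inclusion
`(∀ poly(n)) NEXP ⊆ NEXP` follows from concatenating the witnesses", `NEXPCertificates.lean`).
[cite: ChenEtAl2022, Thm. 1.2 (§5.1, Cor. 3)] -/
theorem constructiveSeparation_of_not_subset_BPP_NEXP_holds : constructiveSeparation_of_not_subset_BPP_NEXP := by
  intro hNB L hL hpad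
  have hBPP_EXP : BPP ⊆ EXP := BPP_subset_SigmaP_two.trans ((SigmaP_subset_PH 2).trans PH_subset_EXP)
  exact hasBPPConstructiveSeparation_of_closure P_subset_NEXP (hBPP_EXP.trans EXP_subset_NEXP)
    (fun _ h₁ _ h₂ => inter_mem_NEXP h₁ h₂) (fun _ h₁ _ h₂ => union_mem_NEXP h₁ h₂)
    (fun _ h f hf => preimage_mem_NEXP_of_mem_FP h hf)
    polyExists_NEXP_subset_NEXP polyForall_NEXP_subset_NEXP hNB hL hpad

end Literature.Computability.MetaComplexity
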